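import Summits.QuantumFields.YangMills.Theorems.FlatTubeReductionKineticLevelSets
import HarnessLib

/-!
# The kinetic defect at a slow datum `u` versus at `u = 1`: `Δ_e(u) = Δ_e(1)·q(u_k) + q(U⁰_e)[q(u_k), q(g_y)]`, so the two defects differ by `O(‖q(u_k) − 1‖·amp(g))` —
# small where the gauge field is near `1`, NOT by `O(‖q(u_k) − 1‖)`
# (tool for the tails AT `u` of the log-free moment machine; route `FlatTubeReduction`, crux K1 `NearFlatRatioLaw` stmt-QuantumFields-24720; seat `ym-line-ftr-p1` g12;
# rate twin «ratepack-v3 / frozen fibres»; R2b1 RECORD rung — no summit statement is proved here)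

WHY (memo `Cruxes/NearFlatRatioLaw/Lines/ratepack-v3-frozen-g12.md` §5.8).  The core+tail sandwich (`…DiagonalMomentSandwichCore`) takes ONE core `S` for the reference density
`ρ₁ ∝ e^{−β·kinDefect(oT 1 v, oT 1 v′, g)}` and for the densities `ρ_u ∝ e^{−β·kinDefect(oT u v, oT u v′, g)}`; a naive comparison of the two levels loses `β‖q(u_k) − 1‖² ≍ βδ₁² ≫ T`.
The exact commutator identity below shows the shift is `2‖q(u_k) − 1‖·‖q(g_y) − 1‖` per edge — quadratic smallness on the region where `g` is near `1` (FP window + small jumps):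
* `edgeDefect_slow_eq` — `q(Xw)b − a·q(X′w) = (q(X)b − a·q(X′))·q(w) + q(X)(q(w)b − b·q(w))` (exact);
* `norm_comm_le` — `‖q(w)b − b q(w)‖ ≤ 2‖q(w) − 1‖‖b − 1‖`; ★ `norm_edgeDefect_slow_le` / `norm_edgeDefect_slow_ge` — `|‖Δ_e(u)‖ − ‖Δ_e(1)‖| ≤ 2‖q(u_k) − 1‖‖q(g_y) − 1‖`;
* ★★ `kinDefect_orthoTube_slow_le` / `kinDefect_orthoTube_slow_ge` — `kinDefect(oT u v, oT u v′, g) ≤ 2·kinDefect(oT 1 v, oT 1 v′, g) + 8|E|τ_u²A²` and the reverse, whenever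
  `‖q(u_k) − 1‖ ≤ τ_u` and `‖q(g_y) − 1‖ ≤ A` for all `k, y`.
HONEST FRAMING: quaternion bookkeeping; femto rung R2b1 (RECORD label); not infinite volume, not a gap, not Clay.  No defs, no named facts, no `sorry`.
-/

set_option autoImplicit false

noncomputable section

open MeasureTheory Filter Topology Real Set
open scoped BigOperators Quaternion
open Literature.MathematicalPhysics.QuantumFieldTheory
open Literature.MathematicalPhysics.QuantumLattice

namespace Summit.QuantumFields.YangMills.Theorems.FemtoTransferGap.RateTube

open Summit.QuantumFields.YangMills.Theorems.FemtoTransferGap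
open Summit.QuantumFields.YangMills.Theorems.FemtoTransferGap.TwoLattice
open Summit.QuantumFields.YangMills.Theorems.FemtoTransferGap.TwoLattice.ConstTube
open Summit.QuantumFields.YangMills.Theorems.FemtoTransferGap.TwoLattice.Avg

variable {L : ℕ} [NeZero L]

/-! ## §1 One edge: the exact commutator identity and its norm bounds -/

omit [NeZero L] in
/-- **Exact**: `q(Xw)·b − a·q(X′w) = (q(X)·b − a·q(X′))·q(w) + q(X)·(q(w)·b − b·q(w))`. [folklore] -/
theorem edgeDefect_slow_eq (X X' w : SU2) (a b : ℍ) :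
    su2Quat (X * w) * b - a * su2Quat (X' * w) = (su2Quat X * b - a * su2Quat X') * su2Quat w + su2Quat X * (su2Quat w * b - b * su2Quat w) := by
  rw [su2Quat_mul, su2Quat_mul]; noncomm_ring

omit [NeZero L] in
/-- `‖q(w)b − b q(w)‖ ≤ 2‖q(w) − 1‖·‖b − 1‖` (`[q(w), b] = [q(w) − 1, b − 1]`). [folklore] -/
theorem norm_comm_le (w : SU2) (b : ℍ) : ‖su2Quat w * b - b * su2Quat w‖ ≤ 2 * ‖su2Quat w - 1‖ * ‖b - 1‖ := by
  have e : su2Quat w * b - b * su2Quat w = (su2Quat w - 1) * (b - 1) - (b - 1) * (su2Quat w - 1) := by noncomm_ring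
  rw [e]
  calc ‖(su2Quat w - 1) * (b - 1) - (b - 1) * (su2Quat w - 1)‖ ≤ ‖(su2Quat w - 1) * (b - 1)‖ + ‖(b - 1) * (su2Quat w - 1)‖ := norm_sub_le _ _
    _ ≤ ‖su2Quat w - 1‖ * ‖b - 1‖ + ‖b - 1‖ * ‖su2Quat w - 1‖ := add_le_add (norm_mul_le _ _) (norm_mul_le _ _)
    _ = 2 * ‖su2Quat w - 1‖ * ‖b - 1‖ := by ring

omit [NeZero L] in
/-- ★ **Upper**: `‖q(Xw)q(g_y) − q(g_x)q(X′w)‖ ≤ ‖q(X)q(g_y) − q(g_x)q(X′)‖ + 2‖q(w) − 1‖‖q(g_y) − 1‖`. [folklore] -/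
theorem norm_edgeDefect_slow_le (X X' w gx gy : SU2) :
    ‖su2Quat (X * w) * su2Quat gy - su2Quat gx * su2Quat (X' * w)‖ ≤ ‖su2Quat X * su2Quat gy - su2Quat gx * su2Quat X'‖ + 2 * ‖su2Quat w - 1‖ * ‖su2Quat gy - 1‖ := by
  rw [edgeDefect_slow_eq]
  calc ‖(su2Quat X * su2Quat gy - su2Quat gx * su2Quat X') * su2Quat w + su2Quat X * (su2Quat w * su2Quat gy - su2Quat gy * su2Quat w)‖
      ≤ ‖(su2Quat X * su2Quat gy - su2Quat gx * su2Quat X') * su2Quat w‖ + ‖su2Quat X * (su2Quat w * su2Quat gy - su2Quat gy * su2Quat w)‖ := norm_add_le _ _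
    _ = ‖su2Quat X * su2Quat gy - su2Quat gx * su2Quat X'‖ + ‖su2Quat w * su2Quat gy - su2Quat gy * su2Quat w‖ := by
        rw [norm_mul, norm_mul, norm_su2Quat, norm_su2Quat, mul_one, one_mul]
    _ ≤ ‖su2Quat X * su2Quat gy - su2Quat gx * su2Quat X'‖ + 2 * ‖su2Quat w - 1‖ * ‖su2Quat gy - 1‖ := add_le_add le_rfl (norm_comm_le w _)

omit [NeZero L] in
/-- ★ **Lower**: `‖q(X)q(g_y) − q(g_x)q(X′)‖ ≤ ‖q(Xw)q(g_y) − q(g_x)q(X′w)‖ + 2‖q(w) − 1‖‖q(g_y) − 1‖`. [folklore] -/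
theorem norm_edgeDefect_slow_ge (X X' w gx gy : SU2) :
    ‖su2Quat X * su2Quat gy - su2Quat gx * su2Quat X'‖ ≤ ‖su2Quat (X * w) * su2Quat gy - su2Quat gx * su2Quat (X' * w)‖ + 2 * ‖su2Quat w - 1‖ * ‖su2Quat gy - 1‖ := by
  have e : (su2Quat X * su2Quat gy - su2Quat gx * su2Quat X') * su2Quat w =
      (su2Quat (X * w) * su2Quat gy - su2Quat gx * su2Quat (X' * w)) - su2Quat X * (su2Quat w * su2Quat gy - su2Quat gy * su2Quat w) := by
    rw [edgeDefect_slow_eq]; abel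
  have h1 : ‖su2Quat X * su2Quat gy - su2Quat gx * su2Quat X'‖ = ‖(su2Quat X * su2Quat gy - su2Quat gx * su2Quat X') * su2Quat w‖ := by
    rw [norm_mul, norm_su2Quat, mul_one]
  rw [h1, e]
  calc ‖(su2Quat (X * w) * su2Quat gy - su2Quat gx * su2Quat (X' * w)) - su2Quat X * (su2Quat w * su2Quat gy - su2Quat gy * su2Quat w)‖
      ≤ ‖su2Quat (X * w) * su2Quat gy - su2Quat gx * su2Quat (X' * w)‖ + ‖su2Quat X * (su2Quat w * su2Quat gy - su2Quat gy * su2Quat w)‖ := norm_sub_le _ _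
    _ = ‖su2Quat (X * w) * su2Quat gy - su2Quat gx * su2Quat (X' * w)‖ + ‖su2Quat w * su2Quat gy - su2Quat gy * su2Quat w‖ := by
        rw [norm_mul, norm_su2Quat, one_mul]
    _ ≤ _ := add_le_add le_rfl (norm_comm_le w _)

/-! ## §2 ★★ The defect of the tube pair at `u` versus at `1` -/

/-- ★★ **Upper shift**: `‖q(u_k) − 1‖ ≤ τ_u` (all `k`) and `‖q(g_y) − 1‖ ≤ A` (all `y`) ⇒ `kinDefect (oT u v) (oT u v′) g ≤ 2·kinDefect (oT 1 v) (oT 1 v′) g + 8|E|·τ_u²·A²`. [folklore] -/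
theorem kinDefect_orthoTube_slow_le (u : GaugeConfig 3 1 SU2) (v v' : Edge 3 L → Fin 3 → ℝ) (g : Site 3 L → SU2) {τu A : ℝ}
    (hu : ∀ k : Fin 3, ‖su2Quat (u (0, k)) - 1‖ ≤ τu) (hA : ∀ y : Site 3 L, ‖su2Quat (g y) - 1‖ ≤ A) :
    kinDefect L (orthoTube L u v) (orthoTube L u v') g ≤ 2 * kinDefect L (orthoTube L 1 v) (orthoTube L 1 v') g + 8 * (Fintype.card (Edge 3 L) : ℝ) * τu ^ 2 * A ^ 2 := by
  have hτ0 : 0 ≤ τu := (norm_nonneg _).trans (hu 0)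
  have hA0 : 0 ≤ A := (norm_nonneg _).trans (hA 0)
  unfold kinDefect
  have he : ∀ e : Edge 3 L, ‖su2Quat (orthoTube L u v e) * su2Quat (g (e.1.shift e.2)) - su2Quat (g e.1) * su2Quat (orthoTube L u v' e)‖ ^ 2 ≤
      2 * ‖su2Quat (orthoTube L 1 v e) * su2Quat (g (e.1.shift e.2)) - su2Quat (g e.1) * su2Quat (orthoTube L 1 v' e)‖ ^ 2 + 2 * (2 * τu * A) ^ 2 := fun e => by
    simp only [orthoTube_apply, Pi.one_apply, mul_one]
    have h1 := norm_edgeDefect_slow_le (chartSU2 (v e)) (chartSU2 (v' e)) (u (0, e.2)) (g e.1) (g (e.1.shift e.2))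
    have h2 : 2 * ‖su2Quat (u (0, e.2)) - 1‖ * ‖su2Quat (g (e.1.shift e.2)) - 1‖ ≤ 2 * τu * A :=
      mul_le_mul (mul_le_mul_of_nonneg_left (hu e.2) (by norm_num)) (hA _) (norm_nonneg _) (by positivity)
    have h3 := pow_le_pow_left₀ (norm_nonneg _) (h1.trans (add_le_add le_rfl h2)) 2
    nlinarith [h3, sq_nonneg (‖su2Quat (chartSU2 (v e)) * su2Quat (g (e.1.shift e.2)) - su2Quat (g e.1) * su2Quat (chartSU2 (v' e))‖ - 2 * τu * A),
      sq_nonneg (‖su2Quat (chartSU2 (v e) * u (0, e.2)) * su2Quat (g (e.1.shift e.2)) - su2Quat (g e.1) * su2Quat (chartSU2 (v' e) * u (0, e.2))‖ - 2 * τu * A)]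
  calc ∑ e : Edge 3 L, ‖su2Quat (orthoTube L u v e) * su2Quat (g (e.1.shift e.2)) - su2Quat (g e.1) * su2Quat (orthoTube L u v' e)‖ ^ 2
      ≤ ∑ e : Edge 3 L, (2 * ‖su2Quat (orthoTube L 1 v e) * su2Quat (g (e.1.shift e.2)) - su2Quat (g e.1) * su2Quat (orthoTube L 1 v' e)‖ ^ 2 + 2 * (2 * τu * A) ^ 2) :=
        Finset.sum_le_sum fun e _ => he e
    _ = 2 * ∑ e : Edge 3 L, ‖su2Quat (orthoTube L 1 v e) * su2Quat (g (e.1.shift e.2)) - su2Quat (g e.1) * su2Quat (orthoTube L 1 v' e)‖ ^ 2 +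
          8 * (Fintype.card (Edge 3 L) : ℝ) * τu ^ 2 * A ^ 2 := by
        rw [Finset.sum_add_distrib, Finset.mul_sum, Finset.sum_const, Finset.card_univ, nsmul_eq_mul]; ring

/-- ★★ **Lower shift**: under the same hypotheses `kinDefect (oT 1 v) (oT 1 v′) g ≤ 2·kinDefect (oT u v) (oT u v′) g + 8|E|·τ_u²·A²`. [folklore] -/
theorem kinDefect_orthoTube_slow_ge (u : GaugeConfig 3 1 SU2) (v v' : Edge 3 L → Fin 3 → ℝ) (g : Site 3 L → SU2) {τu A : ℝ}
    (hu : ∀ k : Fin 3, ‖su2Quat (u (0, k)) - 1‖ ≤ τu) (hA : ∀ y : Site 3 L, ‖su2Quat (g y) - 1‖ ≤ A) :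
    kinDefect L (orthoTube L 1 v) (orthoTube L 1 v') g ≤ 2 * kinDefect L (orthoTube L u v) (orthoTube L u v') g + 8 * (Fintype.card (Edge 3 L) : ℝ) * τu ^ 2 * A ^ 2 := by
  have hτ0 : 0 ≤ τu := (norm_nonneg _).trans (hu 0)
  have hA0 : 0 ≤ A := (norm_nonneg _).trans (hA 0)
  unfold kinDefect
  have he : ∀ e : Edge 3 L, ‖su2Quat (orthoTube L 1 v e) * su2Quat (g (e.1.shift e.2)) - su2Quat (g e.1) * su2Quat (orthoTube L 1 v' e)‖ ^ 2 ≤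
      2 * ‖su2Quat (orthoTube L u v e) * su2Quat (g (e.1.shift e.2)) - su2Quat (g e.1) * su2Quat (orthoTube L u v' e)‖ ^ 2 + 2 * (2 * τu * A) ^ 2 := fun e => by
    simp only [orthoTube_apply, Pi.one_apply, mul_one]
    have h1 := norm_edgeDefect_slow_ge (chartSU2 (v e)) (chartSU2 (v' e)) (u (0, e.2)) (g e.1) (g (e.1.shift e.2))
    have h2 : 2 * ‖su2Quat (u (0, e.2)) - 1‖ * ‖su2Quat (g (e.1.shift e.2)) - 1‖ ≤ 2 * τu * A :=
      mul_le_mul (mul_le_mul_of_nonneg_left (hu e.2) (by norm_num)) (hA _) (norm_nonneg _) (by positivity)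
    have h3 := pow_le_pow_left₀ (norm_nonneg _) (h1.trans (add_le_add le_rfl h2)) 2
    nlinarith [h3, sq_nonneg (‖su2Quat (chartSU2 (v e)) * su2Quat (g (e.1.shift e.2)) - su2Quat (g e.1) * su2Quat (chartSU2 (v' e))‖ - 2 * τu * A),
      sq_nonneg (‖su2Quat (chartSU2 (v e) * u (0, e.2)) * su2Quat (g (e.1.shift e.2)) - su2Quat (g e.1) * su2Quat (chartSU2 (v' e) * u (0, e.2))‖ - 2 * τu * A)]
  calc ∑ e : Edge 3 L, ‖su2Quat (orthoTube L 1 v e) * su2Quat (g (e.1.shift e.2)) - su2Quat (g e.1) * su2Quat (orthoTube L 1 v' e)‖ ^ 2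
      ≤ ∑ e : Edge 3 L, (2 * ‖su2Quat (orthoTube L u v e) * su2Quat (g (e.1.shift e.2)) - su2Quat (g e.1) * su2Quat (orthoTube L u v' e)‖ ^ 2 + 2 * (2 * τu * A) ^ 2) :=
        Finset.sum_le_sum fun e _ => he e
    _ = 2 * ∑ e : Edge 3 L, ‖su2Quat (orthoTube L u v e) * su2Quat (g (e.1.shift e.2)) - su2Quat (g e.1) * su2Quat (orthoTube L u v' e)‖ ^ 2 +
          8 * (Fintype.card (Edge 3 L) : ℝ) * τu ^ 2 * A ^ 2 := by
        rw [Finset.sum_add_distrib, Finset.mul_sum, Finset.sum_const, Finset.card_univ, nsmul_eq_mul]; ring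

end Summit.QuantumFields.YangMills.Theorems.FemtoTransferGap.RateTube

end
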